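import Mathlib.Analysis.SpecialFunctions.Trigonometric.Inverse
import Mathlib.Analysis.SpecialFunctions.Trigonometric.Bounds
import Mathlib.Analysis.Real.Pi.Bounds
import Literature.Computability.QuantumComplexity.QueryPrograms
import Literature.Computability.QuantumComplexity.QueryComplexity
import HarnessLib

/-!
# Grover search with an unknown number of solutions: `Q₂(OR_N) ≤ 76 √N` (Grover 1996; Boyer–Brassard–Høyer–Tapp 1998)

The upper half of the tree fact `Literature.Computability.QuantumComplexity.grover_bbbv`
(`QueryComplexity.lean`, **quantum-advantage.S11**, `Q₂(OR_N) = Θ(√N)`): for all `N ≥ 1`,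
`quantumQueryComplexity (1/3) (orFn N) ≤ 76 √N` (`quantumQueryComplexity_orFn_le`). Together with
the lower half `√N ≤ 4 Q₂(OR_N)` (`GroverSearchLowerBound.lean`, Beals et al. 2001 Thm 4.13 / §6)
this gives `grover_bbbv_holds`, assembled in `QueryComplexityProofs.lean` (the discharge file of
`QueryComplexity.lean`).

* **Upper bound** `Q₂(OR_N) ≤ 19 · 2(⌊√N⌋ + 1) ≤ 76 √N` by an explicit bounded-error algorithm
  `searchAlg N` in the model `QQueryAlg` (programs of `QueryPrograms.lean`):
  1. *Grover's operators* on `Fin N × Bool × Unit` (BBHT 1998, §6): the preparation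
     `|0,0⟩ ↦ u ⊗ |−⟩` (a Householder reflection, "any unitary `T'` with `T'|0⟩ = u` will do"),
     the diffusion `D ⊗ 1`, `D = (2/N)J − 1 = 2|u⟩⟨u| − 1`, the phase kickback
     `O_x (v ⊗ |−⟩) = (S_A v) ⊗ |−⟩`, a target rotation `|−⟩ ↦ |0⟩` and a final checking query
     `O_x (v ⊗ |0⟩) = ∑ v_i |i, x_i⟩` (accept iff the target reads `1`, so nothing is ever accepted
     when `x = 0`).
  2. *BBHT's closed formula* (§3, eq. for `k_j, ℓ_j`): after `j` iterations the index register is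
     `sin((2j+1)θ) good + cos((2j+1)θ) bad`, `sin² θ = t/N` (`grover_iterate`, from
     `reflect_rotate_iterate`), so branch `k` (with `M` queries: `k` iterations, idle phase queries
     that only flip signs, rotation, check) accepts with probability `sin²((2k+1)θ)`
     (`wt_groverBranch`).
  3. *BBHT's Lemma 2* (§4): `∑_{k<M} sin²((2k+1)θ) = M/2 − sin(4Mθ)/(4 sin 2θ)`, hence
     `≥ M/2 − 1/(4 sin 2θ)`; with `sin 2θ ≥ 1/√N` for `1 ≤ t ≤ N−1` and `M = 2(⌊√N⌋+1) ≥ 2√N` the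
     uniform mixture over `k < M` ("choose `j` at random", realised coherently by `mixTok`)
     succeeds with probability `q ∈ [3/8, 1]` (`sum_sin_sq_thetaOf_bounds`; `q = 1` when `t = N`).
  4. *Amplification instead of repetition*: BBHT's Thm 3 repeats the randomised run adaptively
     (expected `O(√(N/t))` queries). For a worst-case bound with a fixed number of queries we damp
     the success probability by a coin of bias `δ = 1/100` (so `a = δq ∈ [3/800, 1/100]` is known
     up to a factor `< 3`) and apply nine rounds of amplitude amplification (BHMT 2002, §2, with
     the basis-state reflection `S_χ` on "target = 1 ∧ coin = 1"): the acceptance probability becomes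
     `sin²(19 θ_a) ≥ 2/3` since `19 θ_a ∈ [1.14, 1.92]` (`sin_sq_nineteen_arcsin_ge`), while for
     `x = 0` it stays `0`. Total queries `M + 9 · 2M = 19M`.

What is NOT here: the expected-time algorithm of BBHT Thm 3 itself (adaptive, needs intermediate
measurements, outside the `QQueryAlg` model), tight constants, and the `O(√(N/t))` refinement.

## References

* L. K. Grover, *A fast quantum mechanical algorithm for database search*, STOC 1996, 212–219
  [Grover1996] (the algorithm; cited by the fact as `STOC1996`).
* M. Boyer, G. Brassard, P. Høyer, A. Tapp, *Tight bounds on quantum searching*, Fortschr. Phys. 46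
  (1998) 493–505: §3 (closed formula), §4 Lemma 1, Lemma 2, Thm 3 (unknown number of solutions),
  §6 (implementation: `T' S_0 T'⁻¹ S_A`), §7 (lower bound) (arXiv:quant-ph/9605034, pp. 2–8, read
  via `lit read arxiv:quant-ph/9605034`) [BoyerEtAl1998].
* G. Brassard, P. Høyer, M. Mosca, A. Tapp, *Quantum amplitude amplification and estimation*,
  Contemp. Math. 305 (2002), §2 eq. (8) (arXiv:quant-ph/0005055, p. 5) [BrassardEtAl2002].
* R. Beals, H. Buhrman, R. Cleve, M. Mosca, R. de Wolf, *Quantum lower bounds by polynomials*,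
  J. ACM 48 (2001), §6 ("`Q₂(OR) ∈ Θ(√N)`") [BealsEtAl2001].
* C. H. Bennett, E. Bernstein, G. Brassard, U. Vazirani, *Strengths and weaknesses of quantum
  computing*, SIAM J. Comput. 26 (1997), Thm 3.5 [BennettBernsteinBrassardVazirani1997].
-/

noncomputable section

namespace Literature.Computability.QuantumComplexity

open Matrix Finset Literature.Computability.Cryptography QProg
open scoped Kronecker

namespace Grover

/-! ### Grover's operators on the basis `Fin N × Bool × Unit` (BBHT 1998, §3 and §6) -/

section GroverOps

variable {N : ℕ}

/-- Product states `v ⊗ m` (index register ⊗ target qubit). [folklore] -/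
def tens (v : Fin N → ℂ) (m : Bool × Unit → ℂ) : Fin N × Bool × Unit → ℂ := fun s => v s.1 * m s.2

/-- Unfolding `tens`. [folklore] -/
@[simp] theorem tens_apply (v : Fin N → ℂ) (m : Bool × Unit → ℂ) (i : Fin N) (p : Bool × Unit) :
    tens v m (i, p) = v i * m p := rfl

/-- `tens` is additive in the index factor. [folklore] -/
theorem tens_add (v w : Fin N → ℂ) (m : Bool × Unit → ℂ) : tens (v + w) m = tens v m + tens w m := by
  funext ⟨i, p⟩; simp [add_mul]

/-- `tens` is homogeneous in the index factor. [folklore] -/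
theorem tens_smul (c : ℂ) (v : Fin N → ℂ) (m : Bool × Unit → ℂ) : tens (c • v) m = c • tens v m := by
  funext ⟨i, p⟩; simp [mul_assoc]

/-- `(A ⊗ 1)(v ⊗ m) = Av ⊗ m`. [folklore] -/
theorem kron_one_mulVec_tens (A : Matrix (Fin N) (Fin N) ℂ) (v : Fin N → ℂ) (m : Bool × Unit → ℂ) :
    (A ⊗ₖ (1 : Matrix (Bool × Unit) (Bool × Unit) ℂ)) *ᵥ tens v m = tens (A *ᵥ v) m := by
  funext ⟨i, p⟩
  simp only [mulVec, dotProduct, tens_apply]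
  rw [Fintype.sum_prod_type]
  simp only [kroneckerMap_apply, tens_apply, one_apply, mul_ite, mul_one, mul_zero, ite_mul,
    zero_mul, Finset.sum_ite_eq, Finset.mem_univ, if_true, Finset.sum_mul]
  refine Finset.sum_congr rfl fun j _ => ?_
  ring

/-- `(1 ⊗ B)(v ⊗ m) = v ⊗ Bm`. [folklore] -/
theorem one_kron_mulVec_tens (B : Matrix (Bool × Unit) (Bool × Unit) ℂ) (v : Fin N → ℂ)
    (m : Bool × Unit → ℂ) :
    ((1 : Matrix (Fin N) (Fin N) ℂ) ⊗ₖ B) *ᵥ tens v m = tens v (B *ᵥ m) := by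
  funext ⟨i, p⟩
  simp only [mulVec, dotProduct, tens_apply]
  rw [Fintype.sum_prod_type]
  simp only [kroneckerMap_apply, tens_apply, one_apply, ite_mul, one_mul, zero_mul, Finset.mul_sum]
  rw [Finset.sum_comm]
  simp only [Finset.sum_ite_eq, Finset.mem_univ, if_true]
  refine Finset.sum_congr rfl fun q _ => ?_
  ring

/-- `1/√2`. [folklore] -/
def rhalf : ℝ := (Real.sqrt 2)⁻¹

/-- `(1/√2)² = 1/2`. [folklore] -/
theorem rhalf_mul_rhalf : rhalf * rhalf = 1 / 2 := by
  rw [rhalf, ← mul_inv, Real.mul_self_sqrt (by norm_num : (0 : ℝ) ≤ 2)]; norm_num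

/-- The target state `|−⟩ = (|0⟩ − |1⟩)/√2`. [folklore] -/
def ketMinus : Bool × Unit → ℂ := fun p => if p.1 then -(rhalf : ℂ) else (rhalf : ℂ)

/-- The target state `|0⟩`. [folklore] -/
def ketZero : Bool × Unit → ℂ := fun p => if p.1 then 0 else 1

/-- The sign flip of the marked amplitudes, `v ↦ S_A v` (BBHT's `S_A`). [cite: BoyerEtAl1998, §6] -/
def flipSign (x : Fin N → Bool) (v : Fin N → ℂ) : Fin N → ℂ := fun i => if x i then -v i else v i

/-- **Phase kickback**: on `v ⊗ |−⟩` the query acts as the sign flip of the marked amplitudes.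
[folklore] -/
theorem queryOracle_mulVec_tens_ketMinus (x : Fin N → Bool) (v : Fin N → ℂ) :
    queryOracle x *ᵥ tens v ketMinus = tens (flipSign x v) ketMinus := by
  funext ⟨i, b, u⟩
  rw [queryOracle_mulVec_apply]
  simp only [tens_apply, ketMinus, flipSign]
  cases x i <;> cases b <;> simp

/-- On `v ⊗ |0⟩` the query writes `x_i` into the target. [folklore] -/
theorem queryOracle_mulVec_tens_ketZero (x : Fin N → Bool) (v : Fin N → ℂ) :
    queryOracle x *ᵥ tens v ketZero = fun s => if s.2.1 = x s.1 then v s.1 else 0 := by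
  funext ⟨i, b, u⟩
  rw [queryOracle_mulVec_apply]
  simp only [tens_apply, ketZero]
  cases x i <;> cases b <;> simp

/-- The real "inversion about the mean" `(2/N) J − 1` on the index register. [cite: BoyerEtAl1998, §6] -/
def diffReal (N : ℕ) : Matrix (Fin N) (Fin N) ℝ :=
  (2 / (N : ℝ)) • vecMulVec (fun _ => (1 : ℝ)) (fun _ => 1) - 1

/-- The real diffusion matrix is an involution (`N ≥ 1`; for `N = 0` it is `−1`). [cite: BoyerEtAl1998, §6] -/
theorem diffReal_mul_self (N : ℕ) : diffReal N * diffReal N = 1 := by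
  set a : ℝ := 2 / (N : ℝ) with ha_def
  set J : Matrix (Fin N) (Fin N) ℝ := vecMulVec (fun _ : Fin N => (1 : ℝ)) (fun _ : Fin N => (1 : ℝ))
    with hJ_def
  have hJ : J * J = (N : ℝ) • J := by
    rw [hJ_def, vecMulVec_mul_vecMulVec]
    ext i j
    simp [vecMulVec_apply, dotProduct]
  have ha : a * a * N = a + a := by
    by_cases h : (N : ℝ) = 0
    · simp [ha_def, h]
    · rw [ha_def]; field_simp; ring
  have h1 : diffReal N = a • J - 1 := rfl
  rw [h1, sub_mul, mul_sub, mul_sub, smul_mul_smul_comm, hJ, smul_smul, ha, add_smul, mul_one, one_mul,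
    one_mul]
  abel

/-- The real diffusion matrix is symmetric. [folklore] -/
theorem diffReal_transpose (N : ℕ) : (diffReal N)ᵀ = diffReal N := by
  simp only [diffReal, transpose_sub, transpose_one, transpose_smul, transpose_vecMulVec]

/-- The diffusion operator on the index register, as a complex matrix. [cite: BoyerEtAl1998, §6] -/
def diffC (N : ℕ) : Matrix (Fin N) (Fin N) ℂ := (diffReal N).map (algebraMap ℝ ℂ)

/-- The diffusion matrix is Hermitian. [folklore] -/
theorem diffC_conjTranspose (N : ℕ) : (diffC N)ᴴ = diffC N := by
  ext i j
  have h := congrFun (congrFun (diffReal_transpose N) i) j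
  rw [transpose_apply] at h
  simp only [diffC, conjTranspose_apply, map_apply, h]
  simp

/-- The diffusion matrix is unitary. [cite: BoyerEtAl1998, §6] -/
theorem diffC_mem_unitaryGroup (N : ℕ) : diffC N ∈ Matrix.unitaryGroup (Fin N) ℂ := by
  rw [Matrix.mem_unitaryGroup_iff, star_eq_conjTranspose, diffC_conjTranspose]
  unfold diffC
  rw [← Matrix.map_mul, diffReal_mul_self]
  simp

/-- The uniform superposition `u = N^{-1/2} ∑ |i⟩`. [folklore] -/
def unifVec (N : ℕ) : Fin N → ℂ := fun _ => (((Real.sqrt N)⁻¹ : ℝ) : ℂ)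

/-- Entries of the diffusion matrix: `2/N − δ_{ij}`. [cite: BoyerEtAl1998, §6] -/
theorem diffC_apply (N : ℕ) (i j : Fin N) :
    diffC N i j = ((2 / (N : ℝ) : ℝ) : ℂ) - if i = j then 1 else 0 := by
  simp only [diffC, map_apply, diffReal, Matrix.sub_apply, Matrix.smul_apply, vecMulVec_apply,
    Matrix.one_apply, smul_eq_mul, mul_one, Complex.coe_algebraMap]
  split_ifs <;> push_cast <;> ring

/-- **The diffusion operator is the reflection about the uniform state**: `D v = 2⟨u, v⟩u − v`
(`N ≥ 1`). [cite: BoyerEtAl1998, §6] -/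
theorem diffC_mulVec [NeZero N] (v : Fin N → ℂ) :
    diffC N *ᵥ v = (2 * (star (unifVec N) ⬝ᵥ v)) • unifVec N - v := by
  have hsq : ((Real.sqrt N)⁻¹ : ℝ) * (Real.sqrt N)⁻¹ = (N : ℝ)⁻¹ := by
    rw [← mul_inv, Real.mul_self_sqrt (Nat.cast_nonneg N)]
  have h2 : ((2 / (N : ℝ) : ℝ) : ℂ) = 2 * ((((Real.sqrt N)⁻¹ : ℝ) : ℂ) * (((Real.sqrt N)⁻¹ : ℝ) : ℂ)) := by
    rw [← Complex.ofReal_mul, hsq]; push_cast; ring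
  funext i
  have lhs : (diffC N *ᵥ v) i = ((2 / (N : ℝ) : ℝ) : ℂ) * ∑ j, v j - v i := by
    simp only [mulVec, dotProduct, diffC_apply, sub_mul, Finset.sum_sub_distrib, ite_mul, one_mul,
      zero_mul, Finset.sum_ite_eq, Finset.mem_univ, if_true]
    rw [← Finset.mul_sum]
  have rhs : ((2 * (star (unifVec N) ⬝ᵥ v)) • unifVec N - v) i =
      2 * ((((Real.sqrt N)⁻¹ : ℝ) : ℂ) * ∑ j, v j) * (((Real.sqrt N)⁻¹ : ℝ) : ℂ) - v i := by
    simp only [Pi.sub_apply, Pi.smul_apply, smul_eq_mul, unifVec, dotProduct, Pi.star_apply,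
      Complex.star_def, Complex.conj_ofReal]
    rw [← Finset.mul_sum]
  rw [lhs, rhs, h2]
  ring

/-- Grover's diffusion operator `D ⊗ 1` on `Fin N × Bool × Unit`, as a unitary. [cite: BoyerEtAl1998, §6] -/
def diffuseGU (N : ℕ) : Matrix.unitaryGroup (Fin N × Bool × Unit) ℂ :=
  ⟨diffC N ⊗ₖ (1 : Matrix (Bool × Unit) (Bool × Unit) ℂ),
    Matrix.kronecker_mem_unitary (diffC_mem_unitaryGroup N) (Submonoid.one_mem _)⟩

/-- `(D ⊗ 1)(v ⊗ m) = (2⟨u,v⟩u − v) ⊗ m` (`N ≥ 1`). [cite: BoyerEtAl1998, §6] -/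
theorem diffuseGU_mulVec_tens [NeZero N] (v : Fin N → ℂ) (m : Bool × Unit → ℂ) :
    (diffuseGU N : Matrix _ _ ℂ) *ᵥ tens v m = tens ((2 * (star (unifVec N) ⬝ᵥ v)) • unifVec N - v) m := by
  rw [← diffC_mulVec]
  exact kron_one_mulVec_tens _ _ _

/-- The target rotation `|−⟩ ↦ |0⟩, |+⟩ ↦ |1⟩` (real orthogonal). [folklore] -/
def trot2 : Matrix (Bool × Unit) (Bool × Unit) ℂ :=
  Matrix.of fun p q => if p.1 then (rhalf : ℂ) else (if q.1 then -(rhalf : ℂ) else (rhalf : ℂ))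

/-- `(1/√2)² = 1/2` in `ℂ`. [folklore] -/
theorem rhalfC_mul_rhalfC : (rhalf : ℂ) * rhalf = 1 / 2 := by
  rw [← Complex.ofReal_mul, rhalf_mul_rhalf]; push_cast; ring

/-- The target rotation is unitary. [folklore] -/
theorem trot2_mem_unitaryGroup : trot2 ∈ Matrix.unitaryGroup (Bool × Unit) ℂ := by
  rw [Matrix.mem_unitaryGroup_iff]
  ext ⟨b, u⟩ ⟨b', u'⟩
  simp only [Matrix.mul_apply, Matrix.star_apply, trot2, Matrix.of_apply, one_apply, Fintype.sum_prod_type,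
    Fintype.sum_bool, Finset.univ_unique, Finset.sum_singleton]
  have h := rhalfC_mul_rhalfC
  have hs : star (rhalf : ℂ) = rhalf := Complex.conj_ofReal _
  cases b <;> cases b' <;> simp [hs, Prod.ext_iff] <;> linear_combination (2 : ℂ) * h

/-- The target rotation sends `|−⟩` to `|0⟩`. [folklore] -/
theorem trot2_mulVec_ketMinus : trot2 *ᵥ ketMinus = ketZero := by
  funext ⟨b, u⟩
  simp only [mulVec, dotProduct, trot2, Matrix.of_apply, ketMinus, ketZero, Fintype.sum_prod_type,
    Fintype.sum_bool, Finset.univ_unique, Finset.sum_singleton]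
  have h := rhalfC_mul_rhalfC
  cases b
  · simp
    linear_combination (2 : ℂ) * h
  · simp

/-- The target rotation on `Fin N × Bool × Unit`, as a unitary. [folklore] -/
def trotGU (N : ℕ) : Matrix.unitaryGroup (Fin N × Bool × Unit) ℂ :=
  ⟨(1 : Matrix (Fin N) (Fin N) ℂ) ⊗ₖ trot2,
    Matrix.kronecker_mem_unitary (Submonoid.one_mem _) trot2_mem_unitaryGroup⟩

/-- `(1 ⊗ T)(v ⊗ |−⟩) = v ⊗ |0⟩`. [folklore] -/
theorem trotGU_mulVec_tens_ketMinus (v : Fin N → ℂ) :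
    (trotGU N : Matrix _ _ ℂ) *ᵥ tens v ketMinus = tens v ketZero := by
  rw [← trot2_mulVec_ketMinus]
  exact one_kron_mulVec_tens _ _ _

/-- The initial basis state `|0, 0⟩`. [folklore] -/
def startG (N : ℕ) [NeZero N] : Fin N × Bool × Unit := (0, false, ())

/-- The (real) amplitudes of the prepared state `u ⊗ |−⟩`. [folklore] -/
def prepVec (N : ℕ) : Fin N × Bool × Unit → ℝ :=
  fun s => (Real.sqrt N)⁻¹ * (if s.2.1 then -rhalf else rhalf)

/-- `u ⊗ |−⟩` is a unit vector (`N ≥ 1`). [folklore] -/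
theorem sum_prepVec_sq [NeZero N] : ∑ s, prepVec N s ^ 2 = 1 := by
  have hN : (N : ℝ) ≠ 0 := Nat.cast_ne_zero.2 (NeZero.ne N)
  have h1 : ∀ s : Fin N × Bool × Unit, prepVec N s ^ 2 = (N : ℝ)⁻¹ * (1 / 2) := fun s => by
    simp only [prepVec]
    rw [mul_pow, inv_pow, Real.sq_sqrt (Nat.cast_nonneg N)]
    congr 1
    split_ifs <;> nlinarith [rhalf_mul_rhalf]
  rw [Finset.sum_congr rfl fun s _ => h1 s, Finset.sum_const, Finset.card_univ, nsmul_eq_mul]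
  simp only [Fintype.card_prod, Fintype.card_fin, Fintype.card_bool, Fintype.card_unit]
  push_cast
  field_simp

/-- The real amplitudes of `u ⊗ |−⟩`, as a complex vector. [folklore] -/
theorem prepVec_cast (N : ℕ) : (fun s => (prepVec N s : ℂ)) = tens (unifVec N) ketMinus := by
  funext ⟨i, b, u⟩
  simp only [prepVec, tens_apply, unifVec, ketMinus]
  split_ifs <;> push_cast <;> ring

/-- The state preparation `|0,0⟩ ↦ u ⊗ |−⟩` (any unitary `T'` with this column will do, BBHT §6),
realised as a Householder reflection. [cite: BoyerEtAl1998, §6] -/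
def preGU (N : ℕ) [NeZero N] : Matrix.unitaryGroup (Fin N × Bool × Unit) ℂ :=
  ⟨householder (prepVec N) (startG N), householder_mem_unitaryGroup _ _⟩

/-- The preparation unitary sends `|0,0⟩` to `u ⊗ |−⟩`. [cite: BoyerEtAl1998, §6] -/
theorem preGU_mulVec_single [NeZero N] :
    (preGU N : Matrix _ _ ℂ) *ᵥ Pi.single (startG N) 1 = tens (unifVec N) ketMinus := by
  rw [← prepVec_cast]
  exact householder_mulVec_single sum_prepVec_sq _

/-- The unitaries of branch `k` of the randomised Grover run with `M` queries: after query
`j+1 ≤ k` the diffusion (an active Grover iteration), idle otherwise; after query `M-1` the target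
rotation `|−⟩ ↦ |0⟩`; after the last (checking) query nothing. [cite: BoyerEtAl1998, §4 Lemma 2] -/
def stepG (N M k j : ℕ) : Matrix.unitaryGroup (Fin N × Bool × Unit) ℂ :=
  if j + 1 = M then 1 else
    (if j + 2 = M then trotGU N else 1) * (if j + 1 ≤ k then diffuseGU N else 1)

/-- Branch `k`: `k` Grover iterations from `u ⊗ |−⟩`, idle phase queries, the target rotation and a
final checking query (`M` queries in all). [cite: BoyerEtAl1998, §4 Lemma 2] -/
def groverBranch (N : ℕ) [NeZero N] (M k : ℕ) : List (QTok N Unit) :=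
  brTok (preGU N) (stepG N M k) M

end GroverOps

/-! ### The Grover plane and the run of one branch (BBHT 1998, §3) -/

section GroverPlane

variable {N : ℕ}

/-- The number `t` of marked items. [folklore] -/
def hw (x : Fin N → Bool) : ℕ := (Finset.univ.filter fun i => x i = true).card

/-- `t ≤ N`. [folklore] -/
theorem hw_le (x : Fin N → Bool) : hw x ≤ N := by
  unfold hw
  exact (Finset.card_filter_le _ _).trans (by simp)

/-- The number of unmarked items is `N − t`. [folklore] -/
theorem card_filter_false (x : Fin N → Bool) : (Finset.univ.filter fun i => x i = false).card = N - hw x := by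
  have h := Finset.card_filter_add_card_filter_not (s := (Finset.univ : Finset (Fin N)))
    (fun i => x i = true)
  simp only [Finset.card_univ, Fintype.card_fin] at h
  have h2 : (Finset.univ.filter fun i => ¬x i = true) = Finset.univ.filter fun i => x i = false := by
    ext i; simp
  rw [h2] at h
  unfold hw
  omega

/-- If some item is unmarked then `t < N`. [folklore] -/
theorem hw_lt_of_eq_false {x : Fin N → Bool} {i : Fin N} (hi : x i = false) : hw x < N := by
  unfold hw
  calc (Finset.univ.filter fun i => x i = true).card < (Finset.univ : Finset (Fin N)).card :=
        Finset.card_lt_card ⟨Finset.filter_subset _ _, fun h => by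
          have := (Finset.mem_filter.1 (h (Finset.mem_univ i))).2; simp [hi] at this⟩
    _ = N := by simp

/-- `t > 0` iff some item is marked. [folklore] -/
theorem hw_pos_iff (x : Fin N → Bool) : 0 < hw x ↔ ∃ i, x i = true := by
  unfold hw
  rw [Finset.card_pos]
  constructor
  · rintro ⟨i, hi⟩; exact ⟨i, (Finset.mem_filter.1 hi).2⟩
  · rintro ⟨i, hi⟩; exact ⟨i, Finset.mem_filter.2 ⟨Finset.mem_univ _, hi⟩⟩

/-- BBHT's angle `θ` with `sin² θ = t/N`. [cite: BoyerEtAl1998, §3] -/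
def thetaOf (x : Fin N → Bool) : ℝ := Real.arcsin (Real.sqrt (hw x / N))

/-- The normalised superposition of the marked items (real amplitudes). [cite: BoyerEtAl1998, §3] -/
def goodR (x : Fin N → Bool) : Fin N → ℝ := fun i => if x i then (Real.sqrt (hw x))⁻¹ else 0

/-- The normalised superposition of the unmarked items (zero when everything is marked). [cite: BoyerEtAl1998, §3] -/
def badR (x : Fin N → Bool) : Fin N → ℝ := fun i => if x i then 0 else (Real.sqrt ((N : ℝ) - hw x))⁻¹

/-- Complex versions. [folklore] -/
def goodC (x : Fin N → Bool) : Fin N → ℂ := fun i => (goodR x i : ℂ)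

/-- Complex versions. [folklore] -/
def badC (x : Fin N → Bool) : Fin N → ℂ := fun i => (badR x i : ℂ)

/-- Inner products of real vectors cast to `ℂ`. [folklore] -/
theorem star_dotProduct_ofReal (u w : Fin N → ℝ) :
    star (fun i => (u i : ℂ)) ⬝ᵥ (fun i => (w i : ℂ)) = ((∑ i, u i * w i : ℝ) : ℂ) := by
  simp [dotProduct, Complex.ofReal_sum]

/-- `sin θ = √(t/N)`. [cite: BoyerEtAl1998, §3] -/
theorem sin_thetaOf (x : Fin N → Bool) : Real.sin (thetaOf x) = Real.sqrt (hw x / N) := by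
  unfold thetaOf
  refine Real.sin_arcsin ?_ ?_
  · linarith [Real.sqrt_nonneg ((hw x : ℝ) / N)]
  · rw [Real.sqrt_le_one]
    rcases Nat.eq_zero_or_pos N with hN | hN
    · subst hN; simp
    · exact div_le_one_of_le₀ (by exact_mod_cast hw_le x) (Nat.cast_nonneg N)

/-- `cos θ = √(1 − t/N)`. [cite: BoyerEtAl1998, §3] -/
theorem cos_thetaOf (x : Fin N → Bool) : Real.cos (thetaOf x) = Real.sqrt (1 - hw x / N) := by
  unfold thetaOf
  rw [Real.cos_arcsin, Real.sq_sqrt]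
  positivity

/-- `∑ good² = 1` when something is marked. [cite: BoyerEtAl1998, §3] -/
theorem sum_goodR_mul_goodR {x : Fin N → Bool} (ht : 0 < hw x) : ∑ i, goodR x i * goodR x i = 1 := by
  have h1 : ∀ i, goodR x i * goodR x i = if x i = true then ((hw x : ℝ))⁻¹ else 0 := fun i => by
    unfold goodR
    split_ifs
    · rw [← mul_inv, Real.mul_self_sqrt (Nat.cast_nonneg _)]
    · simp
  rw [Finset.sum_congr rfl fun i _ => h1 i, Finset.sum_ite, Finset.sum_const_zero, add_zero,
    Finset.sum_const, nsmul_eq_mul]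
  show (hw x : ℝ) * (hw x : ℝ)⁻¹ = 1
  exact mul_inv_cancel₀ (Nat.cast_ne_zero.2 (Nat.pos_iff_ne_zero.1 ht))

/-- `⟨good, good⟩ = 1` when something is marked. [cite: BoyerEtAl1998, §3] -/
theorem goodC_dot_goodC {x : Fin N → Bool} (ht : 0 < hw x) : star (goodC x) ⬝ᵥ goodC x = 1 := by
  unfold goodC
  rw [star_dotProduct_ofReal, sum_goodR_mul_goodR ht]
  simp

/-- `⟨good, bad⟩ = 0`. [cite: BoyerEtAl1998, §3] -/
theorem goodC_dot_badC (x : Fin N → Bool) : star (goodC x) ⬝ᵥ badC x = 0 := by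
  unfold goodC badC
  rw [star_dotProduct_ofReal]
  have h : ∑ i, goodR x i * badR x i = 0 :=
    Finset.sum_eq_zero fun i _ => by unfold goodR badR; split_ifs <;> simp
  rw [h]; simp

/-- `cos θ · ⟨bad, bad⟩ = cos θ` (`⟨bad, bad⟩ = 1` unless everything is marked, when `cos θ = 0`; `N ≥ 1`). [cite: BoyerEtAl1998, §3] -/
theorem cos_mul_badC_dot_badC [NeZero N] (x : Fin N → Bool) :
    (Real.cos (thetaOf x) : ℂ) * (star (badC x) ⬝ᵥ badC x) = Real.cos (thetaOf x) := by
  unfold badC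
  rw [star_dotProduct_ofReal]
  rcases (hw_le x).eq_or_lt with h | h
  · -- everything marked: `cos θ = 0`
    have hc : Real.cos (thetaOf x) = 0 := by
      rw [cos_thetaOf, h, div_self (Nat.cast_ne_zero.2 (NeZero.ne N))]
      simp
    rw [hc]; simp
  · have hsum : ∑ i, badR x i * badR x i = 1 := by
      have h1 : ∀ i, badR x i * badR x i = if x i = false then (((N : ℝ) - hw x))⁻¹ else 0 := fun i => by
        unfold badR
        cases hxi : x i
        · simp only [Bool.false_eq_true, if_false, if_true]
          rw [← mul_inv, Real.mul_self_sqrt (by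
            have : (hw x : ℝ) ≤ N := by exact_mod_cast hw_le x
            linarith)]
        · simp
      rw [Finset.sum_congr rfl fun i _ => h1 i, Finset.sum_ite, Finset.sum_const_zero, add_zero,
        Finset.sum_const, nsmul_eq_mul, card_filter_false, Nat.cast_sub (hw_le x)]
      exact mul_inv_cancel₀ (by
        have : (hw x : ℝ) < N := by exact_mod_cast h
        linarith)
    rw [hsum]; simp

/-- **The uniform state in the Grover plane**: `u = sin θ · good + cos θ · bad` (when something is
marked). [cite: BoyerEtAl1998, §3] -/
theorem unifVec_eq {x : Fin N → Bool} (ht : 0 < hw x) :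
    unifVec N = (Real.sin (thetaOf x) : ℂ) • goodC x + (Real.cos (thetaOf x) : ℂ) • badC x := by
  have hN : 0 < N := lt_of_lt_of_le ht (hw_le x)
  have hNr : (0 : ℝ) < N := by exact_mod_cast hN
  have htr : (0 : ℝ) < hw x := by exact_mod_cast ht
  funext i
  simp only [unifVec, Pi.add_apply, Pi.smul_apply, goodC, badC, goodR, badR, smul_eq_mul,
    sin_thetaOf, cos_thetaOf]
  cases hxi : x i
  · -- unmarked: `t < N`
    have hlt : (hw x : ℝ) < N := by exact_mod_cast hw_lt_of_eq_false hxi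
    have hne : Real.sqrt ((N : ℝ) - hw x) ≠ 0 := Real.sqrt_ne_zero'.2 (by linarith)
    have key : (Real.sqrt N)⁻¹ =
        Real.sqrt (hw x / N) * 0 + Real.sqrt (1 - hw x / N) * (Real.sqrt ((N : ℝ) - hw x))⁻¹ := by
      rw [mul_zero, zero_add, show (1 : ℝ) - hw x / N = ((N : ℝ) - hw x) / N by field_simp,
        Real.sqrt_div' _ hNr.le]
      field_simp
    simp only [Bool.false_eq_true, if_false]
    exact_mod_cast key
  · have hne : Real.sqrt (hw x : ℝ) ≠ 0 := Real.sqrt_ne_zero'.2 htr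
    have key : (Real.sqrt N)⁻¹ =
        Real.sqrt (hw x / N) * (Real.sqrt (hw x))⁻¹ + Real.sqrt (1 - hw x / N) * 0 := by
      rw [mul_zero, add_zero, Real.sqrt_div' _ hNr.le]
      field_simp
    simp only [if_true]
    exact_mod_cast key

/-- The sign flip negates the `good` component. [cite: BoyerEtAl1998, §3] -/
theorem flipSign_plane (x : Fin N → Bool) (α β : ℂ) :
    flipSign x (α • goodC x + β • badC x) = (-α) • goodC x + β • badC x := by
  funext i
  simp only [flipSign, Pi.add_apply, Pi.smul_apply, goodC, badC, goodR, badR, smul_eq_mul]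
  cases x i <;> simp

/-- **BBHT's closed formula** (eq. (5) of §3): after `j` Grover iterations the index register of the
branch is `sin((2j+1)θ) · good + cos((2j+1)θ) · bad`. [cite: BoyerEtAl1998, §3] -/
theorem grover_iterate [NeZero N] {x : Fin N → Bool} (ht : 0 < hw x) (j : ℕ) :
    ((fun v => (2 * (star (unifVec N) ⬝ᵥ v)) • unifVec N - v) ∘ flipSign x)^[j] (unifVec N) =
      (Real.sin ((2 * j + 1) * thetaOf x) : ℂ) • goodC x + (Real.cos ((2 * j + 1) * thetaOf x) : ℂ) • badC x := by
  have hu := unifVec_eq ht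
  conv_lhs => rw [hu]
  refine reflect_rotate_iterate (goodC x) (badC x) (thetaOf x) (goodC_dot_goodC ht) (goodC_dot_badC x)
    (cos_mul_badC_dot_badC x) (flipSign x) _ (flipSign_plane x) (fun v => ?_) j
  rw [← hu]

/-! ### Running one branch -/

/-- The reflection about the uniform state as a map. [folklore] -/
def reflU (N : ℕ) (v : Fin N → ℂ) : Fin N → ℂ := (2 * (star (unifVec N) ⬝ᵥ v)) • unifVec N - v

/-- The index-register state of branch `k` after `q` rounds: `q ∧ k` Grover iterations, then sign
flips only. [cite: BoyerEtAl1998, §3] -/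
def brVec (N k : ℕ) (x : Fin N → Bool) (q : ℕ) : Fin N → ℂ :=
  if q ≤ k then (reflU N ∘ flipSign x)^[q] (unifVec N)
  else (flipSign x)^[q - k] ((reflU N ∘ flipSign x)^[k] (unifVec N))

/-- Initially the index register holds `u`. [folklore] -/
theorem brVec_zero (N k : ℕ) (x : Fin N → Bool) : brVec N k x 0 = unifVec N := by
  simp [brVec]

/-- An active round is a Grover iteration. [cite: BoyerEtAl1998, §3] -/
theorem brVec_succ_of_lt {N k q : ℕ} (x : Fin N → Bool) (h : q + 1 ≤ k) :
    brVec N k x (q + 1) = reflU N (flipSign x (brVec N k x q)) := by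
  rw [brVec, if_pos h, brVec, if_pos (by omega), Function.iterate_succ_apply']
  rfl

/-- An idle round only flips the signs of the marked amplitudes. [folklore] -/
theorem brVec_succ_of_le {N k q : ℕ} (x : Fin N → Bool) (h : k ≤ q) :
    brVec N k x (q + 1) = flipSign x (brVec N k x q) := by
  rw [brVec, if_neg (by omega), brVec]
  by_cases hq : q ≤ k
  · have hqk : q = k := le_antisymm hq h
    subst hqk
    rw [if_pos le_rfl, show q + 1 - q = 1 by omega, Function.iterate_one]
  · rw [if_neg hq, show q + 1 - k = (q - k) + 1 by omega, Function.iterate_succ_apply']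

variable [NeZero N]

omit [NeZero N] in
/-- Before the last two rounds the step is the diffusion or the identity. [folklore] -/
theorem stepG_val_of_lt {M k j : ℕ} (hj : j + 2 < M) :
    ((stepG N M k j : Matrix.unitaryGroup (Fin N × Bool × Unit) ℂ) : Matrix (Fin N × Bool × Unit) (Fin N × Bool × Unit) ℂ) =
      if j + 1 ≤ k then ((diffuseGU N : Matrix.unitaryGroup (Fin N × Bool × Unit) ℂ) : Matrix (Fin N × Bool × Unit) (Fin N × Bool × Unit) ℂ) else 1 := by
  unfold stepG
  rw [if_neg (by omega), if_neg (by omega)]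
  split_ifs <;> simp

omit [NeZero N] in
/-- The last-but-one step ends with the target rotation. [folklore] -/
theorem stepG_val_rot {M k j : ℕ} (hj : j + 2 = M) :
    ((stepG N M k j : Matrix.unitaryGroup (Fin N × Bool × Unit) ℂ) : Matrix (Fin N × Bool × Unit) (Fin N × Bool × Unit) ℂ) =
      ((trotGU N : Matrix.unitaryGroup (Fin N × Bool × Unit) ℂ) : Matrix (Fin N × Bool × Unit) (Fin N × Bool × Unit) ℂ) *
        (if j + 1 ≤ k then ((diffuseGU N : Matrix.unitaryGroup (Fin N × Bool × Unit) ℂ) : Matrix (Fin N × Bool × Unit) (Fin N × Bool × Unit) ℂ) else 1) := by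
  unfold stepG
  rw [if_neg (by omega), if_pos hj]
  split_ifs <;> simp

omit [NeZero N] in
/-- The last step is the identity. [folklore] -/
theorem stepG_val_last {M k j : ℕ} (hj : j + 1 = M) :
    ((stepG N M k j : Matrix.unitaryGroup (Fin N × Bool × Unit) ℂ) : Matrix (Fin N × Bool × Unit) (Fin N × Bool × Unit) ℂ) = 1 := by
  unfold stepG
  rw [if_pos hj]
  simp

/-- One active-or-idle round on the index register. [cite: BoyerEtAl1998, §3] -/
theorem core_round (x : Fin N → Bool) (k q : ℕ) :
    (if q + 1 ≤ k then ((diffuseGU N : Matrix.unitaryGroup (Fin N × Bool × Unit) ℂ) : Matrix (Fin N × Bool × Unit) (Fin N × Bool × Unit) ℂ) else 1) *ᵥ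
        (queryOracle x *ᵥ tens (brVec N k x q) ketMinus) =
      tens (brVec N k x (q + 1)) ketMinus := by
  rw [queryOracle_mulVec_tens_ketMinus]
  by_cases h : q + 1 ≤ k
  · rw [if_pos h, diffuseGU_mulVec_tens, brVec_succ_of_lt x h]
    rfl
  · rw [if_neg h, one_mulVec, brVec_succ_of_le x (by omega)]

/-- **The branch before its last two rounds** stays in `(Grover plane) ⊗ |−⟩`. [cite: BoyerEtAl1998, §3] -/
theorem runTok_brTok_grover (x : Fin N → Bool) (M k : ℕ) :
    ∀ q : ℕ, q + 2 ≤ M →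
      runTok x (brTok (preGU N) (stepG N M k) q) (Pi.single (startG N) 1) = tens (brVec N k x q) ketMinus
  | 0, _ => by
    simp only [brTok, List.range_zero, List.flatMap_nil, runTok_cons, runTok_nil, QTok.mat]
    rw [preGU_mulVec_single, brVec_zero]
  | q + 1, hq => by
    rw [brTok_succ, runTok_append, runTok_brTok_grover x M k q (by omega)]
    simp only [runTok_cons, runTok_nil, QTok.mat]
    rw [stepG_val_of_lt (by omega), core_round]

/-- After the rotation round the target reads `|0⟩`. [cite: BoyerEtAl1998, §3] -/
theorem runTok_brTok_grover_rot (x : Fin N → Bool) {M : ℕ} (k : ℕ) (hM : 2 ≤ M) :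
    runTok x (brTok (preGU N) (stepG N M k) (M - 1)) (Pi.single (startG N) 1) =
      tens (brVec N k x (M - 1)) ketZero := by
  obtain ⟨m, rfl⟩ : ∃ m, M = m + 2 := ⟨M - 2, by omega⟩
  rw [show m + 2 - 1 = m + 1 by omega, brTok_succ, runTok_append, runTok_brTok_grover x (m + 2) k m le_rfl]
  simp only [runTok_cons, runTok_nil, QTok.mat]
  rw [stepG_val_rot rfl, ← mulVec_mulVec, core_round, trotGU_mulVec_tens_ketMinus]

/-- **The final state of a branch**: the checking query writes `x_i` into the target. [cite: BoyerEtAl1998, §3] -/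
theorem runTok_groverBranch (x : Fin N → Bool) {M : ℕ} (k : ℕ) (hM : 2 ≤ M) :
    runTok x (groverBranch N M k) (Pi.single (startG N) 1) =
      fun s => if s.2.1 = x s.1 then brVec N k x (M - 1) s.1 else 0 := by
  unfold groverBranch
  obtain ⟨m, rfl⟩ : ∃ m, M = m + 1 := ⟨M - 1, by omega⟩
  rw [brTok_succ, runTok_append, show m + 1 - 1 = m by omega]
  have h := runTok_brTok_grover_rot (N := N) x k hM
  rw [show m + 1 - 1 = m by omega] at h
  rw [h]
  simp only [runTok_cons, runTok_nil, QTok.mat]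
  rw [stepG_val_last rfl, one_mulVec, queryOracle_mulVec_tens_ketZero]

omit [NeZero N] in
/-- The accepted weight of such a final state is the marked weight of the index register. [folklore] -/
theorem wt_target_true (x : Fin N → Bool) (w : Fin N → ℂ) :
    wt {s : Fin N × Bool × Unit | s.2.1 = true} (fun s => if s.2.1 = x s.1 then w s.1 else 0) =
      ∑ i, if x i = true then ‖w i‖ ^ 2 else 0 := by
  classical
  unfold wt
  rw [Finset.sum_filter]
  rw [Fintype.sum_prod_type]
  refine Finset.sum_congr rfl fun i _ => ?_
  rw [Fintype.sum_prod_type]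
  simp only [Fintype.sum_bool, Finset.univ_unique, Finset.sum_singleton, Set.mem_setOf_eq, if_true,
    Bool.false_eq_true, if_false, add_zero]
  cases x i <;> simp

omit [NeZero N] in
/-- Iterated sign flips on the Grover plane. [folklore] -/
theorem flipSign_iterate_plane (x : Fin N → Bool) (α β : ℂ) (m : ℕ) :
    (flipSign x)^[m] (α • goodC x + β • badC x) = ((-1) ^ m * α) • goodC x + β • badC x := by
  induction m with
  | zero => simp
  | succ m ih => rw [Function.iterate_succ_apply', ih, flipSign_plane]; congr 1; ring_nf

omit [NeZero N] in
/-- The marked weight of `α · good + β · bad` is `|α|²`. [cite: BoyerEtAl1998, §3] -/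
theorem marked_weight_plane {x : Fin N → Bool} (ht : 0 < hw x) (α β : ℂ) :
    (∑ i, if x i = true then ‖(α • goodC x + β • badC x) i‖ ^ 2 else 0) = ‖α‖ ^ 2 := by
  have h1 : ∀ i, (if x i = true then ‖(α • goodC x + β • badC x) i‖ ^ 2 else 0) =
      ‖α‖ ^ 2 * (goodR x i * goodR x i) := fun i => by
    simp only [Pi.add_apply, Pi.smul_apply, smul_eq_mul, goodC, badC, goodR, badR]
    cases x i
    · simp
    · simp only [if_true, Complex.ofReal_zero, mul_zero, add_zero, norm_mul, mul_pow,
        Complex.norm_real, Real.norm_eq_abs, sq_abs]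
      ring
  rw [Finset.sum_congr rfl fun i _ => h1 i, ← Finset.mul_sum, sum_goodR_mul_goodR ht, mul_one]

/-- **Success probability of branch `k`** (BBHT 1998, §3, "the probability of obtaining a solution
is `t k_j² = sin²((2j+1)θ)`"): with `M ≥ 2` queries in all and `k ≤ M − 1` active iterations, on an
input with `t ≥ 1` marked items the branch accepts with probability `sin²((2k+1)θ)`,
`sin² θ = t/N`. [cite: BoyerEtAl1998, §3] -/
theorem wt_groverBranch {x : Fin N → Bool} (ht : 0 < hw x) {M k : ℕ} (hM : 2 ≤ M) (hk : k ≤ M - 1) :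
    wt {s : Fin N × Bool × Unit | s.2.1 = true} (runTok x (groverBranch N M k) (Pi.single (startG N) 1)) =
      Real.sin ((2 * k + 1) * thetaOf x) ^ 2 := by
  rw [runTok_groverBranch x k hM, wt_target_true]
  have hvec : brVec N k x (M - 1) =
      ((-1) ^ (M - 1 - k) * (Real.sin ((2 * k + 1) * thetaOf x) : ℂ)) • goodC x +
        (Real.cos ((2 * k + 1) * thetaOf x) : ℂ) • badC x := by
    rw [brVec]
    by_cases h : M - 1 ≤ k
    · have hk' : k = M - 1 := le_antisymm hk h
      rw [if_pos h, hk', show M - 1 - (M - 1) = 0 by omega, pow_zero, one_mul]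
      exact grover_iterate ht (M - 1)
    · rw [if_neg h]
      rw [show (reflU N ∘ flipSign x) = ((fun v => (2 * (star (unifVec N) ⬝ᵥ v)) • unifVec N - v) ∘ flipSign x)
        from rfl, grover_iterate ht k, flipSign_iterate_plane]
  rw [hvec, marked_weight_plane ht]
  rw [norm_mul, norm_pow, norm_neg, norm_one, one_pow, one_mul, Complex.norm_real, Real.norm_eq_abs, sq_abs]

/-- With nothing marked a branch never accepts (the checking query reads `0`). [folklore] -/
theorem wt_groverBranch_zero {x : Fin N → Bool} (ht : hw x = 0) {M : ℕ} (k : ℕ) (hM : 2 ≤ M) :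
    wt {s : Fin N × Bool × Unit | s.2.1 = true} (runTok x (groverBranch N M k) (Pi.single (startG N) 1)) = 0 := by
  rw [runTok_groverBranch x k hM, wt_target_true]
  refine Finset.sum_eq_zero fun i _ => ?_
  have hxi : x i = false := by
    by_contra h
    have : 0 < hw x := (hw_pos_iff x).2 ⟨i, by simpa using h⟩
    omega
  simp [hxi]

end GroverPlane

/-! ### BBHT's Lemma 2: the average success probability of a random number of iterations -/

section LemmaTwo

open Real

/-- **BBHT 1998, Lemma 1** (the telescoping behind it): `2 sin(2θ) ∑_{k<m} cos((4k+2)θ) = sin(4mθ)`.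
[cite: BoyerEtAl1998, §4 Lemma 1] -/
theorem two_sin_mul_sum_cos (θ : ℝ) (m : ℕ) :
    2 * sin (2 * θ) * ∑ k ∈ Finset.range m, cos ((4 * k + 2) * θ) = sin (4 * m * θ) := by
  induction m with
  | zero => simp
  | succ m ih =>
    rw [Finset.sum_range_succ, mul_add, ih]
    have h := sin_sub_sin (4 * (m + 1 : ℕ) * θ) (4 * m * θ)
    rw [show (4 * ((m + 1 : ℕ) : ℝ) * θ - 4 * m * θ) / 2 = 2 * θ by push_cast; ring,
      show (4 * ((m + 1 : ℕ) : ℝ) * θ + 4 * m * θ) / 2 = (4 * m + 2) * θ by push_cast; ring] at h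
    linarith

/-- **BBHT 1998, Lemma 2** (sum form): `∑_{k<m} sin²((2k+1)θ) = m/2 − (∑_{k<m} cos((4k+2)θ))/2`, so that
`= m/2 − sin(4mθ)/(4 sin 2θ)` when `sin 2θ ≠ 0`. [cite: BoyerEtAl1998, §4 Lemma 2] -/
theorem sum_sin_sq_eq (θ : ℝ) (m : ℕ) :
    ∑ k ∈ Finset.range m, sin ((2 * k + 1) * θ) ^ 2 =
      m / 2 - (∑ k ∈ Finset.range m, cos ((4 * k + 2) * θ)) / 2 := by
  have h : ∀ k : ℕ, sin ((2 * k + 1) * θ) ^ 2 = 1 / 2 - cos ((4 * k + 2) * θ) / 2 := fun k => by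
    rw [sin_sq_eq_half_sub, show 2 * ((2 * (k : ℝ) + 1) * θ) = (4 * k + 2) * θ by ring]
  rw [Finset.sum_congr rfl fun k _ => h k, Finset.sum_sub_distrib, Finset.sum_const, Finset.card_range,
    ← Finset.sum_div]
  simp only [nsmul_eq_mul]
  ring

/-- **BBHT 1998, Lemma 2** (the bound): if `sin 2θ > 0` then the average of `sin²((2k+1)θ)` over
`k < m` is at least `1/2 − 1/(4 m sin 2θ)`; here in the form
`m/2 − 1/(4 sin 2θ) ≤ ∑_{k<m} sin²((2k+1)θ)`. [cite: BoyerEtAl1998, §4 Lemma 2] -/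
theorem sum_sin_sq_ge {θ : ℝ} (hθ : 0 < sin (2 * θ)) (m : ℕ) :
    m / 2 - 1 / (4 * sin (2 * θ)) ≤ ∑ k ∈ Finset.range m, sin ((2 * k + 1) * θ) ^ 2 := by
  rw [sum_sin_sq_eq]
  have h1 := two_sin_mul_sum_cos θ m
  have h2 : sin (4 * m * θ) ≤ 1 := sin_le_one _
  have h3 : ∑ k ∈ Finset.range m, cos ((4 * k + 2) * θ) ≤ 1 / (2 * sin (2 * θ)) := by
    rw [le_div_iff₀ (by positivity)]; nlinarith
  have h4 : 1 / (4 * sin (2 * θ)) = (1 / (2 * sin (2 * θ))) / 2 := by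
    field_simp; ring
  rw [h4]
  linarith

end LemmaTwo

/-! ### The search algorithm: randomised Grover runs, damped, then amplified -/

section Search

variable {N : ℕ}

/-- The coin amplitudes: uniform over the number `k < M` of iterations, and a damping coin with
`P[d = 1] = δ`. [folklore] -/
def coinVec (M : ℕ) (δ : ℝ) : Fin M × Bool → ℝ :=
  fun kd => (Real.sqrt M)⁻¹ * (if kd.2 then Real.sqrt δ else Real.sqrt (1 - δ))

/-- `P[(k, d) = (k, 1)] = δ/M`. [folklore] -/
theorem coinVec_sq_true {M : ℕ} {δ : ℝ} (hδ : 0 ≤ δ) (k : Fin M) : coinVec M δ (k, true) ^ 2 = δ / M := by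
  simp only [coinVec, if_true]
  rw [mul_pow, inv_pow, Real.sq_sqrt (Nat.cast_nonneg M), Real.sq_sqrt hδ]
  ring

/-- `P[(k, d) = (k, 0)] = (1 − δ)/M`. [folklore] -/
theorem coinVec_sq_false {M : ℕ} {δ : ℝ} (hδ : δ ≤ 1) (k : Fin M) : coinVec M δ (k, false) ^ 2 = (1 - δ) / M := by
  simp only [coinVec, Bool.false_eq_true, if_false]
  rw [mul_pow, inv_pow, Real.sq_sqrt (Nat.cast_nonneg M), Real.sq_sqrt (by linarith)]
  ring

/-- The coin amplitudes form a unit vector (`0 ≤ δ ≤ 1`, `M ≥ 1`). [folklore] -/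
theorem sum_coinVec_sq {M : ℕ} [NeZero M] {δ : ℝ} (h0 : 0 ≤ δ) (h1 : δ ≤ 1) :
    ∑ kd, coinVec M δ kd ^ 2 = 1 := by
  rw [Fintype.sum_prod_type]
  simp only [Fintype.sum_bool, coinVec_sq_true h0, coinVec_sq_false h1, Finset.sum_const, Finset.card_univ,
    Fintype.card_fin, nsmul_eq_mul]
  have hM : (M : ℝ) ≠ 0 := Nat.cast_ne_zero.2 (NeZero.ne M)
  field_simp
  ring

/-- The coin preparation unitary. [folklore] -/
def coinU (M : ℕ) [NeZero M] (δ : ℝ) : Matrix.unitaryGroup (Fin M × Bool) ℂ :=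
  ⟨householder (coinVec M δ) (0, false), householder_mem_unitaryGroup _ _⟩

/-- The column of the coin unitary at the initial coin state is the coin amplitude vector. [folklore] -/
theorem coinU_apply {M : ℕ} [NeZero M] {δ : ℝ} (h0 : 0 ≤ δ) (h1 : δ ≤ 1) (kd : Fin M × Bool) :
    (coinU M δ : Matrix (Fin M × Bool) (Fin M × Bool) ℂ) kd (0, false) = (coinVec M δ kd : ℂ) := by
  have h := congrFun (householder_mulVec_single (sum_coinVec_sq (M := M) h0 h1) (0, false)) kd
  rw [mulVec_single_one] at h
  exact h

/-- **The inner algorithm `𝒜`**: the coherent mixture over `k < M` of "`k` Grover iterations and a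
check" (BBHT §4: "choose `j` uniformly at random among the nonnegative integers smaller than `m`,
apply `j` iterations, observe"), with a damping coin. [cite: BoyerEtAl1998, §4 Lemma 2] -/
def innerTok (N M : ℕ) [NeZero N] [NeZero M] (δ : ℝ) : List (QTok N (Unit × (Fin M × Bool))) :=
  mixTok (coinU M δ) (fun _ => preGU N) (fun kd j => stepG N M kd.1 j) M

/-- The initial basis state of the search algorithm. [folklore] -/
def startS (N M : ℕ) [NeZero N] [NeZero M] : Fin N × Bool × (Unit × (Fin M × Bool)) :=
  (0, false, ((), (0, false)))

/-- The accepting branch states: for damping coin `d = 1` the target must read `1` (the checked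
item is marked); for `d = 0` nothing is accepted. [folklore] -/
def accBr (N : ℕ) (d : Bool) : Set (Fin N × Bool × Unit) := if d then {s | s.2.1 = true} else ∅

/-- For `d = 1` the accepting branch states are `target = 1`. [folklore] -/
@[simp] theorem accBr_true (N : ℕ) : accBr N true = {s | s.2.1 = true} := rfl

/-- For `d = 0` no branch state is accepting. [folklore] -/
@[simp] theorem accBr_false (N : ℕ) : accBr N false = ∅ := rfl

/-- The accepting basis states of the search algorithm: the damping coin reads `1` and the target
reads `1`. [folklore] -/
def GoodS (N M : ℕ) (σ : Fin N × Bool × (Unit × (Fin M × Bool))) : Prop :=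
  (σ.1, σ.2.1, σ.2.2.1) ∈ accBr N σ.2.2.2.2

/-- A basis state is accepting iff the damping coin and the target both read `1`. [folklore] -/
theorem goodS_iff (N M : ℕ) (σ : Fin N × Bool × (Unit × (Fin M × Bool))) :
    GoodS N M σ ↔ σ.2.2.2.2 = true ∧ σ.2.1 = true := by
  unfold GoodS accBr
  cases σ.2.2.2.2 <;> simp

/-- Acceptance is decidable. [folklore] -/
instance GoodS.decidablePred (N M : ℕ) : DecidablePred (GoodS N M) := fun σ =>
  decidable_of_iff _ (goodS_iff N M σ).symm

/-- The empty set has weight `0`. [folklore] -/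
theorem wt_empty {ι : Type*} [Fintype ι] (v : ι → ℂ) : wt (∅ : Set ι) v = 0 := by
  classical
  simp [wt]

/-- `𝒜` makes `M` queries. [folklore] -/
theorem numQueries_innerTok (N M : ℕ) [NeZero N] [NeZero M] (δ : ℝ) : numQueries (innerTok N M δ) = M :=
  numQueries_mixTok _ _ _ _

/-- Success probability of branch `k < M` (restating `wt_groverBranch`). [cite: BoyerEtAl1998, §3] -/
theorem wt_brTok_eq [NeZero N] {M : ℕ} (hM : 2 ≤ M) {x : Fin N → Bool} (ht : 0 < hw x) (k : Fin M) :
    wt {s : Fin N × Bool × Unit | s.2.1 = true} (runTok x (brTok (preGU N) (stepG N M k) M) (Pi.single (startG N) 1)) =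
      Real.sin ((2 * (k : ℕ) + 1) * thetaOf x) ^ 2 :=
  wt_groverBranch ht hM (by have := k.2; omega)

/-- With nothing marked branch `k` never accepts. [folklore] -/
theorem wt_brTok_eq_zero [NeZero N] {M : ℕ} (hM : 2 ≤ M) {x : Fin N → Bool} (ht : hw x = 0) (k : Fin M) :
    wt {s : Fin N × Bool × Unit | s.2.1 = true} (runTok x (brTok (preGU N) (stepG N M k) M) (Pi.single (startG N) 1)) = 0 :=
  wt_groverBranch_zero ht k hM

/-- The accepting weight prepared by `𝒜`, branch by branch. [folklore] -/
theorem wt_innerTok_eq_sum [NeZero N] {M : ℕ} [NeZero M] {δ : ℝ} (h0 : 0 ≤ δ) (h1 : δ ≤ 1) (x : Fin N → Bool) :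
    wt {σ | GoodS N M σ} (runTok x (innerTok N M δ) (Pi.single (startS N M) 1)) =
      ∑ k : Fin M, δ / M * wt {s : Fin N × Bool × Unit | s.2.1 = true}
        (runTok x (brTok (preGU N) (stepG N M k) M) (Pi.single (startG N) 1)) := by
  have hrun := runTok_mixTok x (coinU M δ) (fun _ => preGU N) (fun kd j => stepG N M kd.1 j) M (startG N) (0, false)
  change runTok x (innerTok N M δ) (Pi.single (startS N M) 1) = _ at hrun
  rw [hrun]
  have hset := wt_liftVec (N := N) (W' := Unit) (K := Fin M × Bool) (fun kd => accBr N kd.2)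
    (fun kd => ((coinU M δ : Matrix (Fin M × Bool) (Fin M × Bool) ℂ) kd (0, false)) •
      runTok x (brTok (preGU N) (stepG N M kd.1) M) (Pi.single (startG N) 1))
  change wt {σ | GoodS N M σ} _ = _ at hset
  rw [hset, Fintype.sum_prod_type]
  refine Finset.sum_congr rfl fun k _ => ?_
  rw [Fintype.sum_bool, wt_smul, wt_smul, coinU_apply h0 h1, coinU_apply h0 h1]
  simp only [accBr_true, accBr_false, wt_empty, mul_zero, add_zero, Complex.norm_real, Real.norm_eq_abs,
    sq_abs, coinVec_sq_true h0]

/-- **The weight prepared by `𝒜`** on the accepting states: `(δ/M) ∑_{k<M} sin²((2k+1)θ)` when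
something is marked. [cite: BoyerEtAl1998, §4 Lemma 2] -/
theorem wt_innerTok [NeZero N] {M : ℕ} [NeZero M] (hM : 2 ≤ M) {δ : ℝ} (h0 : 0 ≤ δ) (h1 : δ ≤ 1)
    {x : Fin N → Bool} (ht : 0 < hw x) :
    wt {σ | GoodS N M σ} (runTok x (innerTok N M δ) (Pi.single (startS N M) 1)) =
      δ / M * ∑ k ∈ Finset.range M, Real.sin ((2 * k + 1) * thetaOf x) ^ 2 := by
  rw [wt_innerTok_eq_sum h0 h1, ← Finset.mul_sum, Finset.sum_congr rfl fun k _ => wt_brTok_eq hM ht k,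
    Finset.sum_range (fun k => Real.sin ((2 * k + 1) * thetaOf x) ^ 2)]

/-- With nothing marked `𝒜` prepares no accepting weight. [folklore] -/
theorem wt_innerTok_zero [NeZero N] {M : ℕ} [NeZero M] (hM : 2 ≤ M) {δ : ℝ} (h0 : 0 ≤ δ) (h1 : δ ≤ 1)
    {x : Fin N → Bool} (ht : hw x = 0) :
    wt {σ | GoodS N M σ} (runTok x (innerTok N M δ) (Pi.single (startS N M) 1)) = 0 := by
  rw [wt_innerTok_eq_sum h0 h1]
  exact Finset.sum_eq_zero fun k _ => by rw [wt_brTok_eq_zero hM ht k, mul_zero]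

/-- The number of branches `M = 2(⌊√N⌋ + 1) > 2√N`. [folklore] -/
def Mof (N : ℕ) : ℕ := 2 * (Nat.sqrt N + 1)

/-- `M ≠ 0`. [folklore] -/
instance Mof.neZero (N : ℕ) : NeZero (Mof N) := ⟨by unfold Mof; omega⟩

/-- `M ≥ 2`. [folklore] -/
theorem two_le_Mof (N : ℕ) : 2 ≤ Mof N := by unfold Mof; omega

/-- `2√N ≤ M`. [folklore] -/
theorem two_sqrt_le_Mof (N : ℕ) : 2 * Real.sqrt N ≤ Mof N := by
  have h : (N : ℝ) < ((Nat.sqrt N + 1 : ℕ) : ℝ) ^ 2 := by exact_mod_cast Nat.lt_succ_sqrt' N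
  have h2 : Real.sqrt N ≤ ((Nat.sqrt N + 1 : ℕ) : ℝ) := by
    rw [Real.sqrt_le_left (by positivity)]; exact h.le
  unfold Mof; push_cast at h2 ⊢; linarith

/-- `M ≤ 4√N` for `N ≥ 1`. [folklore] -/
theorem Mof_le (hN : 1 ≤ N) : (Mof N : ℝ) ≤ 4 * Real.sqrt N := by
  have h1 : ((Nat.sqrt N : ℕ) : ℝ) ≤ Real.sqrt N := by
    rw [Real.le_sqrt (by positivity) (by positivity)]; exact_mod_cast Nat.sqrt_le' N
  have h2 : (1 : ℝ) ≤ Real.sqrt N := by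
    rw [show (1 : ℝ) = Real.sqrt 1 by simp]; exact Real.sqrt_le_sqrt (by exact_mod_cast hN)
  unfold Mof; push_cast; linarith

/-- The damping `δ = 1/100` and `j = 9` amplification rounds. [folklore] -/
def searchTok (N : ℕ) [NeZero N] : List (QTok N (Unit × (Fin (Mof N) × Bool))) :=
  iterTok (innerTok N (Mof N) (1 / 100)) (aaRound (innerTok N (Mof N) (1 / 100)) (startS N (Mof N)) (GoodS N (Mof N))) 9

/-- **The bounded-error quantum search algorithm for `OR_N`** with `19 · 2(⌊√N⌋+1) = O(√N)`
queries: the damped uniform mixture of Grover runs (BBHT 1998), amplified nine times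
(BHMT 2002). [cite: BoyerEtAl1998, §4 Thm 3] -/
def searchAlg (N : ℕ) [NeZero N] : QQueryAlg N :=
  toAlg (searchTok N) (startS N (Mof N)) {σ | GoodS N (Mof N) σ}

/-- The search algorithm makes `19 M` queries. [folklore] -/
theorem searchAlg_queries (N : ℕ) [NeZero N] : (searchAlg N).queries = 19 * Mof N := by
  unfold searchAlg searchTok
  rw [toAlg_queries, numQueries_iterTok, numQueries_aaRound, numQueries_innerTok]
  ring

/-- The acceptance probability of the search algorithm is the accepting weight after nine amplification rounds of `𝒜`. [folklore] -/
theorem searchAlg_acceptProb (N : ℕ) [NeZero N] (x : Fin N → Bool) :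
    (searchAlg N).acceptProb x =
      wt {σ | GoodS N (Mof N) σ} ((runTok x (aaRound (innerTok N (Mof N) (1 / 100)) (startS N (Mof N))
        (GoodS N (Mof N))))^[9] (runTok x (innerTok N (Mof N) (1 / 100)) (Pi.single (startS N (Mof N)) 1))) := by
  unfold searchAlg searchTok
  rw [toAlg_acceptProb, runTok_iterTok]

/-! ### Numerical estimates -/

/-- `sin 2θ ≥ 1/√N` when `1 ≤ t ≤ N − 1`. [cite: BoyerEtAl1998, §4 (proof of Thm 3: `m₀ = 1/sin 2θ < √(N/t)`)] -/
theorem sin_two_thetaOf_ge [NeZero N] {x : Fin N → Bool} (ht : 0 < hw x) (htN : hw x < N) :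
    (Real.sqrt N)⁻¹ ≤ Real.sin (2 * thetaOf x) := by
  have hNr : (0 : ℝ) < N := by exact_mod_cast lt_of_le_of_lt (Nat.zero_le _) htN
  have htr : (1 : ℝ) ≤ hw x := by exact_mod_cast ht
  have htN' : (hw x : ℝ) + 1 ≤ N := by exact_mod_cast htN
  set p : ℝ := hw x / N with hp
  have hp0 : 0 ≤ p := by positivity
  have hp1 : p ≤ 1 := div_le_one_of_le₀ (by linarith) hNr.le
  have hsin : Real.sin (2 * thetaOf x) = 2 * Real.sqrt p * Real.sqrt (1 - p) := by
    rw [Real.sin_two_mul, sin_thetaOf, cos_thetaOf]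
  have hprod : (N : ℝ)⁻¹ ≤ 4 * (p * (1 - p)) := by
    have key : (N : ℝ) ≤ 4 * (hw x * (N - hw x)) := by nlinarith
    rw [hp]
    rw [show 4 * ((hw x : ℝ) / N * (1 - hw x / N)) = 4 * (hw x * (N - hw x)) / (N * N) by field_simp]
    rw [inv_eq_one_div, div_le_div_iff₀ hNr (by positivity)]
    nlinarith
  have h2 : Real.sin (2 * thetaOf x) ^ 2 = 4 * (p * (1 - p)) := by
    rw [hsin, mul_pow, mul_pow, Real.sq_sqrt hp0, Real.sq_sqrt (by linarith)]; ring
  have hnonneg : 0 ≤ Real.sin (2 * thetaOf x) := by rw [hsin]; positivity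
  calc (Real.sqrt N)⁻¹ = Real.sqrt ((N : ℝ)⁻¹) := by rw [Real.sqrt_inv]
    _ ≤ Real.sqrt (Real.sin (2 * thetaOf x) ^ 2) := Real.sqrt_le_sqrt (by rw [h2]; exact hprod)
    _ = Real.sin (2 * thetaOf x) := Real.sqrt_sq hnonneg

/-- **The randomised stage succeeds with constant probability** (BBHT Lemma 2 with `m ≥ 2√N ≥ 2/sin 2θ`):
`(3/8) M ≤ ∑_{k<M} sin²((2k+1)θ) ≤ M` whenever something is marked. [cite: BoyerEtAl1998, §4 Lemma 2] -/
theorem sum_sin_sq_thetaOf_bounds [NeZero N] {x : Fin N → Bool} (ht : 0 < hw x) {M : ℕ}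
    (hM : 2 * Real.sqrt N ≤ M) :
    3 / 8 * (M : ℝ) ≤ ∑ k ∈ Finset.range M, Real.sin ((2 * k + 1) * thetaOf x) ^ 2 ∧
      ∑ k ∈ Finset.range M, Real.sin ((2 * k + 1) * thetaOf x) ^ 2 ≤ M := by
  constructor
  · rcases (hw_le x).eq_or_lt with h | h
    · -- everything marked: `θ = π/2`, every term is `1`
      have hθ : thetaOf x = Real.pi / 2 := by
        unfold thetaOf
        rw [h, div_self (Nat.cast_ne_zero.2 (NeZero.ne N)), Real.sqrt_one, Real.arcsin_one]
      have hneg : ∀ k : ℕ, ((-1 : ℝ) ^ k) ^ 2 = 1 := fun k => by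
        rw [← pow_mul, Nat.mul_comm, pow_mul, neg_one_sq, one_pow]
      have hterm : ∀ k : ℕ, Real.sin ((2 * k + 1) * thetaOf x) ^ 2 = 1 := fun k => by
        rw [hθ, show (2 * (k : ℝ) + 1) * (Real.pi / 2) = k * Real.pi + Real.pi / 2 by ring,
          Real.sin_add_pi_div_two, Real.cos_nat_mul_pi, hneg]
      rw [Finset.sum_congr rfl fun k _ => hterm k, Finset.sum_const, Finset.card_range]
      simp only [nsmul_eq_mul, mul_one]
      linarith
    · have hs := sin_two_thetaOf_ge ht h
      have hNr : (0 : ℝ) < N := by exact_mod_cast lt_of_le_of_lt (Nat.zero_le _) h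
      have hsN : 0 < (Real.sqrt N)⁻¹ := by positivity
      have hspos : 0 < Real.sin (2 * thetaOf x) := lt_of_lt_of_le hsN hs
      have hb := sum_sin_sq_ge hspos M
      have h4 : 1 / (4 * Real.sin (2 * thetaOf x)) ≤ Real.sqrt N / 4 := by
        rw [div_le_div_iff₀ (by positivity) (by norm_num)]
        have : 1 ≤ Real.sqrt N * Real.sin (2 * thetaOf x) := by
          calc (1 : ℝ) = Real.sqrt N * (Real.sqrt N)⁻¹ := by
                rw [mul_inv_cancel₀ (Real.sqrt_ne_zero'.2 hNr)]
            _ ≤ Real.sqrt N * Real.sin (2 * thetaOf x) := by gcongr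
        nlinarith
      linarith
  · calc ∑ k ∈ Finset.range M, Real.sin ((2 * k + 1) * thetaOf x) ^ 2 ≤ ∑ _k ∈ Finset.range M, (1 : ℝ) :=
          Finset.sum_le_sum fun k _ => by rw [sq_le_one_iff_abs_le_one]; exact Real.abs_sin_le_one _
      _ = M := by simp

/-- The arithmetic of the final amplification: for `a ∈ [3/800, 1/100]`,
`sin²(19 · arcsin √a) ≥ 2/3` (`19 θ_a ∈ [1.14, 1.92]` is within `0.44` of `π/2`). [folklore] -/
theorem sin_sq_nineteen_arcsin_ge {a : ℝ} (ha0 : 3 / 800 ≤ a) (ha1 : a ≤ 1 / 100) :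
    2 / 3 ≤ Real.sin ((2 * (9 : ℕ) + 1) * Real.arcsin (Real.sqrt a)) ^ 2 := by
  set θ := Real.arcsin (Real.sqrt a) with hθ
  have hsa0 : (6 : ℝ) / 100 ≤ Real.sqrt a := by
    rw [show (6 : ℝ) / 100 = Real.sqrt ((6 / 100) ^ 2) by rw [Real.sqrt_sq (by norm_num)]]
    exact Real.sqrt_le_sqrt (by nlinarith)
  have hsa1 : Real.sqrt a ≤ 1 / 10 := by
    rw [show (1 : ℝ) / 10 = Real.sqrt ((1 / 10) ^ 2) by rw [Real.sqrt_sq (by norm_num)]]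
    exact Real.sqrt_le_sqrt (by nlinarith)
  have hθ0 : 0 ≤ θ := Real.arcsin_nonneg.2 (Real.sqrt_nonneg a)
  -- lower bound: `√a = sin θ ≤ θ`
  have hlo : (6 : ℝ) / 100 ≤ θ := by
    have h1 : Real.sin θ = Real.sqrt a :=
      Real.sin_arcsin (by linarith [Real.sqrt_nonneg a]) (by linarith)
    have h2 : Real.sin θ ≤ θ := Real.sin_le hθ0
    linarith
  have hpi_lo : (3 : ℝ) < Real.pi := Real.pi_gt_three
  have hpi_hi : Real.pi < 63 / 20 := by
    have h := Real.pi_lt_d2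
    norm_num at h
    exact h
  -- upper bound: `θ ≤ arcsin (1/10) ≤ 0.101`
  have hhi : θ ≤ 101 / 1000 := by
    have h1 : θ ≤ Real.arcsin (1 / 10) := Real.arcsin_le_arcsin hsa1
    have h2 : Real.arcsin (1 / 10) ≤ 101 / 1000 := by
      rw [Real.arcsin_le_iff_le_sin ⟨by norm_num, by norm_num⟩ ⟨by linarith, by linarith⟩]
      have h3 := Real.sin_gt_sub_cube (x := (101 : ℝ) / 1000) (by norm_num)
      nlinarith
    linarith
  have hdist : |(2 * ((9 : ℕ) : ℝ) + 1) * θ - Real.pi / 2| ≤ 44 / 100 := by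
    rw [abs_le]; constructor <;> push_cast <;> nlinarith
  have hcos : 1 - (44 / 100 : ℝ) ^ 2 / 2 ≤ Real.sin ((2 * ((9 : ℕ) : ℝ) + 1) * θ) := by
    rw [← Real.cos_sub_pi_div_two]
    refine le_trans ?_ Real.one_sub_sq_div_two_le_cos
    have := sq_abs ((2 * ((9 : ℕ) : ℝ) + 1) * θ - Real.pi / 2)
    nlinarith [abs_nonneg ((2 * ((9 : ℕ) : ℝ) + 1) * θ - Real.pi / 2)]
  nlinarith

/-- **The search algorithm computes `OR_N` with error `≤ 1/3`**: on inputs with a marked item it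
accepts with probability `sin²(19 θ_a) ≥ 2/3` (`a = δq`, `q ≥ 3/8` by BBHT Lemma 2), and with nothing
marked it never accepts. [cite: BoyerEtAl1998, §4 Thm 3] -/
theorem searchAlg_computes (N : ℕ) [NeZero N] :
    (searchAlg N).ComputesWithError (1 / 3) Set.univ (orFn N) := by
  intro x _
  rw [searchAlg_acceptProb]
  have hM2 := two_le_Mof N
  constructor
  · intro hx
    have ht : 0 < hw x := (hw_pos_iff x).2 ((orFn_eq_true_iff x).1 hx)
    have hwt := wt_innerTok (N := N) (M := Mof N) hM2 (δ := 1 / 100) (by norm_num) (by norm_num) ht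
    obtain ⟨hlo, hhi⟩ := sum_sin_sq_thetaOf_bounds ht (two_sqrt_le_Mof N)
    have hMpos : (0 : ℝ) < Mof N := by exact_mod_cast lt_of_lt_of_le (by norm_num) hM2
    have ha0 : 3 / 800 ≤ wt {σ | GoodS N (Mof N) σ}
        (runTok x (innerTok N (Mof N) (1 / 100)) (Pi.single (startS N (Mof N)) 1)) := by
      rw [hwt, div_mul_eq_mul_div, le_div_iff₀ hMpos]; linarith
    have ha1 : wt {σ | GoodS N (Mof N) σ}
        (runTok x (innerTok N (Mof N) (1 / 100)) (Pi.single (startS N (Mof N)) 1)) ≤ 1 / 100 := by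
      rw [hwt, div_mul_eq_mul_div, div_le_iff₀ hMpos]; linarith
    rw [wt_aa_iterate x _ _ _ (by linarith) (by linarith) 9]
    have := sin_sq_nineteen_arcsin_ge ha0 ha1
    linarith
  · intro hx
    have ht : hw x = 0 := by
      by_contra h
      have : orFn N x = true := (orFn_eq_true_iff x).2 ((hw_pos_iff x).1 (Nat.pos_of_ne_zero h))
      simp [hx] at this
    rw [wt_aa_iterate_zero x _ _ _ (wt_innerTok_zero (N := N) (M := Mof N) hM2 (δ := 1 / 100)
      (by norm_num) (by norm_num) ht) 9]
    norm_num

end Search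

end Grover

open Grover

variable {N : ℕ}

/-- **The upper bound `Q₂(OR_N) ≤ 76 √N`** (Grover 1996; BBHT 1998, Thm 3 for an unknown number of
solutions; Beals et al. 2001, §6: "we can also compute the OR-function with high success probability
in `O(√N)`: let Grover's algorithm generate an index `i`, and return `x_i`"). [cite: BoyerEtAl1998, §4 Thm 3] -/
theorem quantumQueryComplexity_orFn_le (hN : 1 ≤ N) :
    (quantumQueryComplexity (1 / 3) (orFn N) : ℝ) ≤ 76 * Real.sqrt N := by
  haveI : NeZero N := NeZero.of_pos hN
  have hmem : (searchAlg N).queries ∈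
      {T | ∃ A : QQueryAlg N, A.queries = T ∧ A.ComputesWithError (1 / 3) Set.univ (orFn N)} :=
    ⟨searchAlg N, rfl, searchAlg_computes N⟩
  have hle : quantumQueryComplexity (1 / 3) (orFn N) ≤ 19 * Mof N := by
    rw [← searchAlg_queries]
    exact Nat.sInf_le hmem
  have hle' : (quantumQueryComplexity (1 / 3) (orFn N) : ℝ) ≤ 19 * (Mof N : ℝ) := by exact_mod_cast hle
  have hM := Mof_le hN
  linarith


end Literature.Computability.QuantumComplexity

end
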